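import Literature.MathematicalPhysics.QuantumFieldTheory.Balaban1983to89.B13DeltaALocalFamily
import Literature.MathematicalPhysics.QuantumFieldTheory.Balaban1983to89.B13ScaledPencilBondAveraging
import Literature.MathematicalPhysics.QuantumFieldTheory.Balaban1983to89.B13EntryLetterSockets
import Literature.MathematicalPhysics.QuantumFieldTheory.Balaban1983to89.B13DeltaAPencilLettersLocated

/-!
# `Balaban1983to89.B13DeltaALocalScaledPencil` — T. Bałaban, *Propagators for lattice gauge theories in a background field*, Commun. Math. Phys. **99** (1985) 389–434
# [Balaban1985BackgroundPropagators], (3.10) p. 392, (3.12)–(3.14) pp. 392–393, (3.26) p. 395, (3.35)–(3.37) p. 396 («|A′| < α₁(Lʲη)⁻¹ on Ω_j»), (3.40) p. 397, Thm 3.4 and (3.50)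
# p. 400, Thm 3.10 (3.107)–(3.108) p. 416; [Balaban1984PropagatorsII] (2.18)–(2.19) p. 226; [Balaban1988RG2Cluster] (2.5)–(2.7) pp. 12–13, p. 15: ★★ THE LOCAL PART `Δ(U) + Q*(U)aQ(U)` OF
# NODE 00's `Δ_a(U)` ALONG THE (3.37)-SCALED PENCIL `A″ ↦ e^{iη(w·A″)}U₀` WITH A LEVEL-FREE AVERAGING NUMERAL — station W5's instance (this seat's `B13DeltaALocalFamily` §2) fed by
# dag-n10-w5 g4's W4b `B13ScaledPencilBondAveraging` (the bond-averaging transporters along the scaled pencil, block by block), plus the one-line TRANSFER of ANY plain-pencil letters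
# datum to the scaled pencil (dag-n10-w3 g5's `B13EntryLetterSockets.rawEntryLetters_comp` over W5 §4).

THE DISPLAY.  W5 §2 (`rawEntryLetters_toMatrix_localDeltaA_of_family`) reads, for ANY background family, the Hessian facts `hHh ∕ hH` and the bond-averaging transporter facts
`hQh hQhi hQf hQb hQsf hQsb`; W5 §4 supplies `hHh ∕ hH ∕ hQh ∕ hQhi` along dag-n10-w3's scaled pencil `prodCfg U₀ η (fun μ y => ((w y : ℝ) : ℂ) • a μ y)` for `|w| ≤ 1`, and W4b's
`norm_qT_parBY_scaledPencil_binders` supplies `hQf hQb hQsf hQsb` with ONE numeral `K_Q = K₀^{(d+2)(L^k−1)}·e^{c_w(d+2)|η|Rc}` under its DISPLAYED box-weight binder `hwQ` (the weight is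
`≤ c_w·(Lʲ)⁻¹` on the averaging box of every level-`j` coarse bond; `c_w` located by dag-n10-w5, not fixed here).  §2 of THIS FILE is that ONE application; §3 its edition at the record
`(M_N(ℂ), matrix units, bondReadingY, G ≤ U(N))`, where `K₀ = 1` makes `K_Q = e^{c_w(d+2)|η|Rc}` LEVEL- AND k-FREE (W4b §3) and every 76-numeral is the number of this seat's
`B13DeltaAPencilLettersLocated` (`c₁ = 4|c_f|`, `c₂ = 4(d+1)|c_f|`, `N_b = 4(d+1)`, `c_Q = 1`, `c_{Q*} = 2`, `c_a = |b₁|c_f²(L^k)^{d+1}`, `cb = cl = 1`, `s = 2(d+2)(L^k−1)`).  §1 is the transfer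
lemma (w3's GO, INBOX l.40209): a letters datum of ANY chart functional along the plain chart pulls back to the scaled chart with the SAME `(Rc, ρ, B)` when `|w| ≤ 1` — so every
bond- ∕ plaquette-local plain-pencil station is already a scaled-pencil station; only the averaging transports gain (W4 ∕ W4b).

[folklore] one `rawEntryLetters_comp`, one application of W5 §2, one located substitution; kernel-checked; THEOREMS ONLY (no `def`, no `structure`, no instance, no notation); NOTHING of
NODE 00's ∕ the lane's ∕ dag-n10-w3's ∕ dag-n10-w5's ∕ dag-n10-w6's files is modified; nothing here is a claim about the Yang–Mills mass gap; no node is discharged; count-neutral.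

WHY THIS FILE (cell `pub-ymgap`, HUMAN RULING D-0062 ∕ D-0149, Track A node N10 = [B13]; WIDTH SEAT `pub-ymgap-dag-n10-w4` g6, INTENT-7 ∕ CLAIM-7 (R455 (A)); lane census v21.2 item 6
(the W-leaf of LOCATED (c)); dag-n10-w5 g4 «W5's scaled instance: the `Q ∕ Q*` transporter facts = W4b §2∕§3 BY NAME with `c_w` displayed» (INBOX l.40283); dag-n10-w3 g5 «(o5) yours, GO» (l.40209)).

WHAT THIS FILE PROVES (all `theorem`s; `K_η = K₀e^{|η|Rc}`).
* §1 ★ `rawEntryLetters_scaledPencil_of_chart` (ANY `T` on NODE 00's chart: `RawEntryLetters T loc Rc ρ B` ⟹ `RawEntryLetters (A″ ↦ T(w·A″)) loc Rc ρ B`, `|w| ≤ 1`) and its pencil reading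
  ★ `rawEntryLetters_scaledPencil_of_prodCfg` (`T := Δ ∘ prodCfg U₀ η`).
* §2 ★★ `rawEntryLetters_toMatrix_localDeltaA_scaledPencil` — W5 §2 along the scaled pencil: constant `cb·(M_H·cl + c_{Q*}(K_Q(c_a(c_Q(K_Q·cl·K_Q)))K_Q))·e^{ρs}`, `M_H = c₂c₁K_η⁸ + 8N_bc_f²K_η⁸`,
  `K_Q = K₀^{(d+2)(L^k−1)}·e^{c_w(d+2)|η|Rc}`; displayed `‖U₀^{±1}‖ ≤ K₀`, `1 ≤ K₀`, `0 ≤ Rc`, `|w| ≤ 1`, W4b's `hwQ` with `0 ≤ c_w`, 76's numerals and reading facts.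
* §3 ★★ `rawEntryLetters_toMatrix_localDeltaA_scaledPencil_located` — the record edition: `K_Q = e^{c_w(d+2)|η|Rc}`, every 76-numeral a number, `ℓB := bondReadingY`; displayed ONLY `hG`, `hU₀`,
  `hNf`, `η`, `0 ≤ Rc`, `0 ≤ ρ`, `|w| ≤ 1`, `hwQ`, `0 ≤ c_w`.
HONEST FRAMING: letter algebra over cited tree theorems; the box-weight numeral `c_w` and WHICH weight is «of record» (print's `(Lʲη)⁻¹`) stay displayed ∕ NODE 00's ∕ the lane's word;
finite-lattice constants, not print's `O(1)`; nothing of Bałaban's asserted; N06 ∕ N10 NOT discharged; K1⁹ stmt-QuantumFields-27364 OPEN, no registered stub proved; counts unmoved (typed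
28∕28 · discharged 5∕27); 0 `def`, 0 `sorry`, standard axioms; one finite 𝕋⁴ programme at fixed ε, Bałaban AS PRINTED — R4 closes the conditional finite-𝕋⁴ rung `BalabanLadder.UV` only;
the YM mass gap (Clay) is NOT proved by any of this; nothing continuum ∕ ℝ⁴ ∕ OS.  Filed `--kind proof --supports stmt-QuantumFields-27364`, Literature lane.

References: T. Bałaban, CMP 99 (1985) 389–434 [Balaban1985BackgroundPropagators] (3.10) p.392, (3.12)–(3.14) pp.392–393, (3.26) p.395, (3.35)–(3.37) p.396, (3.40) p.397, Thm 3.4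
and (3.50) p.400, Thm 3.10 (3.107)–(3.108) p.416; CMP 96 (1984) 223–250 [Balaban1984PropagatorsII] (2.18)–(2.19) p.226; CMP 116 (1988) 1–22 [Balaban1988RG2Cluster] (2.5)–(2.7)
pp.12–13, p.15.
-/

noncomputable section

namespace Literature.MathematicalPhysics.QuantumFieldTheory.Balaban1983to89.B13DeltaALocalScaledPencil

open Metric Set Finset Module
open scoped Matrix Matrix.Norms.L2Operator
open Literature.MathematicalPhysics.QuantumFieldTheory.Balaban1983to89
open Literature.MathematicalPhysics.QuantumFieldTheory.Balaban1983to89.B9Thm37GlueTorus (tdist1)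
open Literature.MathematicalPhysics.QuantumFieldTheory.Balaban1983to89.B5TorusCover (UT)
open Literature.MathematicalPhysics.QuantumFieldTheory.Balaban1983to89.B13EntrywiseWalks (RawEntryLetters)
open Literature.MathematicalPhysics.QuantumFieldTheory.Balaban1983to89.B13EntryLetterSockets (rawEntryLetters_comp)
open Literature.MathematicalPhysics.QuantumFieldTheory.Balaban1983to89.B9Eq39Adjoint (prodCfg)
open Literature.MathematicalPhysics.QuantumFieldTheory.Balaban1983to89.B6GlobalChartV1 (PV)
open Literature.MathematicalPhysics.QuantumFieldTheory.Balaban1983to89.B6KLevelCensusIndexV1 (KIdx)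
open Literature.MathematicalPhysics.QuantumFieldTheory.Balaban1983to89.B15DeterminingSets (embIter)
open Literature.MathematicalPhysics.QuantumFieldTheory.Balaban1983to89.Node00 (FBondY IBondY PlaqY CfgY curlK cocurlK qK qsK aK qT edgeY hessY QY QsY aY parBY toKT)
open Literature.MathematicalPhysics.QuantumFieldTheory.Balaban1983to89.B13DeltaALocalFamily
  (differentiable_weightScale mapsTo_weightScale_ball differentiableOn_hessY_scaledPencil differentiableOn_qT_scaledPencil norm_hessY_scaledPencil_le
    rawEntryLetters_toMatrix_localDeltaA_of_family)
open Literature.MathematicalPhysics.QuantumFieldTheory.Balaban1983to89.B13ScaledPencilBondAveraging (norm_qT_parBY_scaledPencil_binders)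
open Literature.MathematicalPhysics.QuantumFieldTheory.Balaban1983to89.B13CurlIncidenceNumerals (sum_abs_curlK_le sum_abs_cocurlK_le card_filter_edgeY_le)
open Literature.MathematicalPhysics.QuantumFieldTheory.Balaban1983to89.B13DeltaAPencilLettersLocated (hcQ_le_one hcQs_le_two hca_of_globalBand ca_globalBand_nonneg hℓp_bondReadingY_rangeQ2)
open Literature.MathematicalPhysics.QuantumFieldTheory.Balaban1983to89.B13BondAveragingReadingNumerals (hℓq_bondReadingY)
open Literature.MathematicalPhysics.QuantumFieldTheory.Balaban1983to89.B13MatrixUnitBasisNumerals (norm_stdBasis_repr_le norm_stdBasis_le_one)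
open Literature.MathematicalPhysics.QuantumFieldTheory.Balaban1983to89.B13GreenPrimeSymLettersOfReg335 (norm_unit_le_one_of_mem)
open Literature.MathematicalPhysics.QuantumFieldTheory.Balaban1983to89.B13BlockBondReadingNumerals (bondReadingY)

variable {𝔸 : Type} [NormedRing 𝔸] [NormedAlgebra ℂ 𝔸] [CompleteSpace 𝔸]
variable {d ℓ : ℕ} {hd : 1 ≤ d + 1} {hL : Odd (ℓ + 1) ∧ 1 < ℓ + 1} {b₀ b₁ : ℝ}
variable (i : KIdx d ℓ hd hL b₀ b₁) (w : Site (PV d ℓ i.m i.K hd hL) 0 → ℝ)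

/-! ## §1. ★ The transfer: ANY letters datum on NODE 00's chart pulls back to the (3.37)-scaled chart with the same `(Rc, ρ, B)` when `|w| ≤ 1` -/

section Transfer

variable {ν : ℕ} {Nf : Fin ν → ℕ} [∀ j, NeZero (Nf j)]
variable {p : Type}

omit [CompleteSpace 𝔸] in
/-- ★ **THE SCALED CHART IS A PULLBACK OF THE PLAIN CHART**: for ANY family `T` of matrices on NODE 00's chart with letters `(Rc, ρ, B)` and any real weight `|w| ≤ 1`,
`A″ ↦ T(w·A″)` has the SAME letters `(Rc, ρ, B)` (dag-n10-w3's `rawEntryLetters_comp` at the chart-diagonal scaling of W5 §4, which is holomorphic and maps the ball into itself).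
Every bond- ∕ plaquette-local plain-pencil station (D ∕ D* families, Hessian, holonomies, the local part with its k-dependent numeral) is thereby a scaled-pencil station with
UNCHANGED constants; only the averaging transports improve (W4 ∕ W4b). [cite: Balaban1985BackgroundPropagators, (3.35)–(3.37) p.396, Thm 3.4 p.400, (3.108) p.416; Balaban1988RG2Cluster, p.15] -/
theorem rawEntryLetters_scaledPencil_of_chart {T : (Fin (d + 1) → Site (PV d ℓ i.m i.K hd hL) 0 → 𝔸) → Matrix p p ℂ} {loc : p → UT Nf} {Rc ρ B : ℝ}
    (h : RawEntryLetters T loc Rc ρ B) (hw : ∀ y, |w y| ≤ 1) :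
    RawEntryLetters (fun a : Fin (d + 1) → Site (PV d ℓ i.m i.K hd hL) 0 → 𝔸 => T (fun μ y => ((w y : ℝ) : ℂ) • a μ y)) loc Rc ρ B :=
  rawEntryLetters_comp h (differentiable_weightScale i w).differentiableOn (mapsTo_weightScale_ball i w hw)

/-- ★ … read at pv27's pencil: letters of `A′ ↦ Δ(e^{iηA′}U₀)` give the same letters of `A″ ↦ Δ(e^{iη(w·A″)}U₀)` (`|w| ≤ 1`), for ANY functional `Δ` of the configuration.
[cite: Balaban1985BackgroundPropagators, (3.35)–(3.37) p.396, Thm 3.4 p.400, (3.108) p.416] -/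
theorem rawEntryLetters_scaledPencil_of_prodCfg (U₀ : CfgY 𝔸 i) (η : ℝ) {Δ : CfgY 𝔸 i → Matrix p p ℂ} {loc : p → UT Nf} {Rc ρ B : ℝ}
    (h : RawEntryLetters (fun a : Fin (d + 1) → Site (PV d ℓ i.m i.K hd hL) 0 → 𝔸 => Δ (prodCfg U₀ η a)) loc Rc ρ B) (hw : ∀ y, |w y| ≤ 1) :
    RawEntryLetters (fun a : Fin (d + 1) → Site (PV d ℓ i.m i.K hd hL) 0 → 𝔸 => Δ (prodCfg U₀ η (fun μ y => ((w y : ℝ) : ℂ) • a μ y))) loc Rc ρ B :=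
  rawEntryLetters_scaledPencil_of_chart i w h hw

end Transfer

/-! ## §2. ★★ The local part along the scaled pencil: W5 §2 fed by W5 §4 (Hessian, holomorphy) and W4b (the level-free averaging numeral) -/

section Scaled

variable [NormOneClass 𝔸]
variable {ν : ℕ} {Nf : Fin ν → ℕ} [∀ j, NeZero (Nf j)]
variable {κ : Type} [Fintype κ] [DecidableEq κ] (b : Basis κ ℂ 𝔸)
variable (U₀ : CfgY 𝔸 i) (η : ℝ) {K₀ Rc cw : ℝ}

open Classical in
/-- ★★ **THE LOCAL PART `Δ(U) + Q*(U)aQ(U)` ALONG THE (3.37)-SCALED PENCIL `U = e^{iη(w·A″)}U₀`** — ONE application of W5 §2 `rawEntryLetters_toMatrix_localDeltaA_of_family` at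
`F := prodCfg U₀ η (w·)`, `parB := parBY`: the Hessian facts from W5 §4 (`differentiableOn_hessY_scaledPencil`, `norm_hessY_scaledPencil_le` at the SAME `K_η = K₀e^{|η|Rc}`), the
transporter holomorphy from W5 §4 (`differentiableOn_qT_scaledPencil`), the transporter numeral from dag-n10-w5's W4b `norm_qT_parBY_scaledPencil_binders`:
`K_Q = K₀^{(d+2)(L^k−1)}·e^{c_w(d+2)|η|Rc}` under the displayed box-weight binder `hwQ`.  Conclusion: for every `ρ ≥ 0`,
`RawEntryLetters (A″ ↦ toMatrix B′B′ (Δ(U) + (Q*aQ)(U))) (ℓB ∘ fst) Rc ρ (cb·(M_H·cl + c_{Q*}(K_Q(c_a(c_Q(K_Q·cl·K_Q)))K_Q))·e^{ρs})`, `M_H = c₂c₁K_η⁸ + 8N_bc_f²K_η⁸`.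
[cite: Balaban1985BackgroundPropagators, (3.10) p.392, (3.12)–(3.14) pp.392–393, (3.26) p.395, (3.35)–(3.37) p.396, (3.40) p.397, Thm 3.4 and (3.50) p.400, Thm 3.10 (3.107)–(3.108) p.416; Balaban1984PropagatorsII, (2.18)–(2.19) p.226; Balaban1988RG2Cluster, (2.5) p.12, p.15] -/
theorem rawEntryLetters_toMatrix_localDeltaA_scaledPencil
    (hU : ∀ μ x, ‖(U₀ μ x : 𝔸)‖ ≤ K₀) (hUi : ∀ μ x, ‖(((U₀ μ x)⁻¹ : 𝔸ˣ) : 𝔸)‖ ≤ K₀) (hK1 : 1 ≤ K₀) (hRc : 0 ≤ Rc)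
    (hw : ∀ y, |w y| ≤ 1) (hcw : 0 ≤ cw)
    (hwQ : ∀ (ι : IBondY i) (v : Site (PV d ℓ i.m i.K hd hL) 0),
      (∀ ν', (v ν' - (((ι.1.2.src ν').val * (ℓ + 1) ^ (ι.1.1 : ℕ) : ℕ) : ZMod ((PV d ℓ i.m i.K hd hL).sitesPerDir 0))).val < 2 * (ℓ + 1) ^ (ι.1.1 : ℕ)) →
        |w v| ≤ cw * ((((ℓ : ℝ) + 1) ^ (ι.1.1 : ℕ)))⁻¹)
    {c₁ c₂ : ℝ} (hc₀ : 0 ≤ c₁) (hc₂0 : 0 ≤ c₂) (hc₁ : ∀ p, ∑ b', |curlK i p b'| ≤ c₁) (hc₂ : ∀ b', ∑ p, |cocurlK i b' p| ≤ c₂)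
    {Nb : ℝ} (hNb0 : 0 ≤ Nb)
    (hNb : ∀ b' : FBondY i,
      ((((Finset.univ : Finset (PlaqY i)) ×ˢ (Finset.univ : Finset (Fin 4))).filter fun pm => edgeY i pm.1 pm.2 = b').card : ℝ) ≤ Nb)
    {cQ cQs ca : ℝ} (hcQ0 : 0 ≤ cQ) (hcQs0 : 0 ≤ cQs) (hca0 : 0 ≤ ca) (hcQ : ∀ ι, ∑ b', |qK i ι b'| ≤ cQ) (hcQs : ∀ b', ∑ ι, |qsK i b' ι| ≤ cQs)
    (hca : ∀ ι, ∑ ι', |aK i ι ι'| ≤ ca)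
    {cb cl : ℝ} (hcb : ∀ (a : 𝔸) (k : κ), ‖b.repr a k‖ ≤ cb * ‖a‖) (hcb0 : 0 ≤ cb) (hcl : ∀ l, ‖b l‖ ≤ cl) (hcl0 : 0 ≤ cl)
    (ℓB : FBondY i → UT Nf) {s : ℝ}
    (hℓp : ∀ p m l, tdist1 Nf (ℓB (edgeY i p m)) (ℓB (edgeY i p l)) ≤ s)
    (hℓq : ∀ b₁ ι ι' b₂, qsK i b₁ ι ≠ 0 → aK i ι ι' ≠ 0 → qK i ι' b₂ ≠ 0 → tdist1 Nf (ℓB b₁) (ℓB b₂) ≤ s)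
    {ρ : ℝ} (hρ : 0 ≤ ρ) :
    RawEntryLetters (fun a : Fin (d + 1) → Site (PV d ℓ i.m i.K hd hL) 0 → 𝔸 =>
        LinearMap.toMatrix ((Pi.basis fun _ : FBondY i => b).reindex (Equiv.sigmaEquivProd (FBondY i) κ))
          ((Pi.basis fun _ : FBondY i => b).reindex (Equiv.sigmaEquivProd (FBondY i) κ))
          (hessY i (prodCfg U₀ η (fun μ y => ((w y : ℝ) : ℂ) • a μ y)) +
            QsY i (parBY i) (prodCfg U₀ η (fun μ y => ((w y : ℝ) : ℂ) • a μ y)) ∘ₗ aY i ∘ₗ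
              QY i (parBY i) (prodCfg U₀ η (fun μ y => ((w y : ℝ) : ℂ) • a μ y))))
      (fun q : FBondY i × κ => ℓB q.1) Rc ρ
      (cb * ((c₂ * c₁ * (K₀ * Real.exp (|η| * Rc)) ^ 8 + 8 * (Nb * i.cf ^ 2) * (K₀ * Real.exp (|η| * Rc)) ^ 8) * cl +
        cQs * ((K₀ ^ ((d + 2) * ((ℓ + 1) ^ i.k - 1)) * Real.exp (cw * (((d : ℝ) + 2) * (|η| * Rc)))) *
          (ca * (cQ * ((K₀ ^ ((d + 2) * ((ℓ + 1) ^ i.k - 1)) * Real.exp (cw * (((d : ℝ) + 2) * (|η| * Rc)))) * cl *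
            (K₀ ^ ((d + 2) * ((ℓ + 1) ^ i.k - 1)) * Real.exp (cw * (((d : ℝ) + 2) * (|η| * Rc))))))) *
          (K₀ ^ ((d + 2) * ((ℓ + 1) ^ i.k - 1)) * Real.exp (cw * (((d : ℝ) + 2) * (|η| * Rc)))))) * Real.exp (ρ * s)) := by
  have hK0 : 0 ≤ K₀ := zero_le_one.trans hK1
  have hKη0 : 0 ≤ K₀ * Real.exp (|η| * Rc) := mul_nonneg hK0 (Real.exp_nonneg _)
  have hMH : 0 ≤ c₂ * c₁ * (K₀ * Real.exp (|η| * Rc)) ^ 8 + 8 * (Nb * i.cf ^ 2) * (K₀ * Real.exp (|η| * Rc)) ^ 8 :=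
    add_nonneg (mul_nonneg (mul_nonneg hc₂0 hc₀) (pow_nonneg hKη0 _)) (mul_nonneg (mul_nonneg (by norm_num) (mul_nonneg hNb0 (sq_nonneg _))) (pow_nonneg hKη0 _))
  have hKQ : 0 ≤ K₀ ^ ((d + 2) * ((ℓ + 1) ^ i.k - 1)) * Real.exp (cw * (((d : ℝ) + 2) * (|η| * Rc))) := mul_nonneg (pow_nonneg hK0 _) (Real.exp_nonneg _)
  obtain ⟨hQf, hQb, hQsf, hQsb⟩ := norm_qT_parBY_scaledPencil_binders i U₀ η w hU hUi hK1 hRc hcw hwQ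
  exact rawEntryLetters_toMatrix_localDeltaA_of_family i (parBY i) (fun a => prodCfg U₀ η (fun μ y => ((w y : ℝ) : ℂ) • a μ y)) b
    (fun Λ b' => differentiableOn_hessY_scaledPencil i U₀ η w hw Λ b') hMH
    (fun u hu Λ b' => norm_hessY_scaledPencil_le i U₀ η w hw hU hUi hK1 hRc hc₀ hc₁ hc₂ hNb hu Λ b')
    (fun ι b' => (differentiableOn_qT_scaledPencil i U₀ η w hw ι b').1) (fun ι b' => (differentiableOn_qT_scaledPencil i U₀ η w hw ι b').2) hKQ
    hQf hQb hQsf hQsb hcQ0 hcQs0 hca0 hcQ hcQs hca hcb hcb0 hcl hcl0 ℓB hℓp hℓq hρ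

end Scaled

/-! ## §3. ★★ The record edition: `(M_N(ℂ), matrix units, bondReadingY, G ≤ U(N))` — `K_Q = e^{c_w(d+2)|η|Rc}` level- and k-free, every 76-numeral a number -/

section Located

variable {N : ℕ} [NeZero N] {G : Subgroup (Matrix (Fin N) (Fin N) ℂ)ˣ}
variable {Nf : Fin (d + 1) → ℕ} [∀ μ, NeZero (Nf μ)]

open Classical in
/-- ★★ **THE LOCAL PART ALONG THE SCALED PENCIL AT THE RECORD — LEVEL- AND k-FREE AVERAGING NUMERAL.**  For a `G`-valued background `U₀` (`G ≤ U(N)`, so `K₀ = 1`), matrix-unit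
coordinates (`cb = cl = 1`), bonds read by `bondReadingY` (`s = 2(d+2)(L^k−1)`), the NODE-00 numerals of this seat's `B13DeltaAPencilLettersLocated` (`c₁ = 4|c_f|`, `c₂ = 4(d+1)|c_f|`,
`N_b = 4(d+1)`, `c_Q = 1`, `c_{Q*} = 2`, `c_a = |b₁|c_f²(L^k)^{d+1}`) and W4b's record numeral `K_Q = e^{c_w(d+2)|η|Rc}`:
`RawEntryLetters (A″ ↦ toMatrix (Δ(U) + (Q*aQ)(U))) (bondReadingY ∘ fst) Rc ρ N(η, Rc, c_w)·e^{ρs}` with `N` free of the level and of `L^k` except through `c_a` and `s` (print's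
weight `a` and the reading range — not transports).  DISPLAYED ONLY: `hG`, `hU₀`, `hNf`, `η`, `0 ≤ Rc`, `0 ≤ ρ`, `|w| ≤ 1`, `hwQ`, `0 ≤ c_w`.  Compare this seat's plain-pencil
`B13DeltaAPencilLettersLocated.rawEntryLetters_toMatrix_localDeltaA_prodCfg_located`, whose averaging factors are `(e^{|η|Rc})^{(d+2)(L^k−1)}`.
[cite: Balaban1985BackgroundPropagators, (3.10) p.392, (3.12)–(3.14) pp.392–393, (3.26) p.395, (3.35)–(3.37) p.396, Thm 3.4 and (3.50) p.400, Thm 3.10 (3.107)–(3.108) p.416; Balaban1988RG2Cluster, (2.5) p.12, p.15] -/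
theorem rawEntryLetters_toMatrix_localDeltaA_scaledPencil_located
    (hG : G ≤ B7Prop2Explicit.unitaryUnits (Matrix (Fin N) (Fin N) ℂ))
    {U₀ : CfgY (Matrix (Fin N) (Fin N) ℂ) i} (hU₀ : ∀ μ x, U₀ μ x ∈ G)
    (hNf : ∀ μ, (toKT i).NB μ = Nf μ) (η : ℝ) {Rc : ℝ} (hRc : 0 ≤ Rc) {ρ : ℝ} (hρ : 0 ≤ ρ)
    (hw : ∀ y, |w y| ≤ 1) {cw : ℝ} (hcw : 0 ≤ cw)
    (hwQ : ∀ (ι : IBondY i) (v : Site (PV d ℓ i.m i.K hd hL) 0),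
      (∀ ν', (v ν' - (((ι.1.2.src ν').val * (ℓ + 1) ^ (ι.1.1 : ℕ) : ℕ) : ZMod ((PV d ℓ i.m i.K hd hL).sitesPerDir 0))).val < 2 * (ℓ + 1) ^ (ι.1.1 : ℕ)) →
        |w v| ≤ cw * ((((ℓ : ℝ) + 1) ^ (ι.1.1 : ℕ)))⁻¹) :
    RawEntryLetters (fun a : Fin (d + 1) → Site (PV d ℓ i.m i.K hd hL) 0 → Matrix (Fin N) (Fin N) ℂ =>
        LinearMap.toMatrix ((Pi.basis fun _ : FBondY i => Matrix.stdBasis ℂ (Fin N) (Fin N)).reindex (Equiv.sigmaEquivProd (FBondY i) (Fin N × Fin N)))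
          ((Pi.basis fun _ : FBondY i => Matrix.stdBasis ℂ (Fin N) (Fin N)).reindex (Equiv.sigmaEquivProd (FBondY i) (Fin N × Fin N)))
          (hessY i (prodCfg U₀ η (fun μ y => ((w y : ℝ) : ℂ) • a μ y)) +
            QsY i (parBY i) (prodCfg U₀ η (fun μ y => ((w y : ℝ) : ℂ) • a μ y)) ∘ₗ aY i ∘ₗ
              QY i (parBY i) (prodCfg U₀ η (fun μ y => ((w y : ℝ) : ℂ) • a μ y))))
      (fun q : FBondY i × (Fin N × Fin N) => bondReadingY i hNf q.1) Rc ρ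
      (1 * ((4 * ((d : ℝ) + 1) * |i.cf| * (4 * |i.cf|) * (1 * Real.exp (|η| * Rc)) ^ 8 + 8 * (4 * ((d : ℝ) + 1) * i.cf ^ 2) * (1 * Real.exp (|η| * Rc)) ^ 8) * 1 +
        2 * ((1 ^ ((d + 2) * ((ℓ + 1) ^ i.k - 1)) * Real.exp (cw * (((d : ℝ) + 2) * (|η| * Rc)))) *
          ((|b₁| * i.cf ^ 2 * ((((ℓ + 1 : ℕ) : ℝ)) ^ i.k) ^ (d + 1)) *
            (1 * ((1 ^ ((d + 2) * ((ℓ + 1) ^ i.k - 1)) * Real.exp (cw * (((d : ℝ) + 2) * (|η| * Rc)))) * 1 *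
              (1 ^ ((d + 2) * ((ℓ + 1) ^ i.k - 1)) * Real.exp (cw * (((d : ℝ) + 2) * (|η| * Rc))))))) *
          (1 ^ ((d + 2) * ((ℓ + 1) ^ i.k - 1)) * Real.exp (cw * (((d : ℝ) + 2) * (|η| * Rc)))))) *
        Real.exp (ρ * (2 * (((d : ℝ) + 2) * ((((ℓ + 1) ^ i.k : ℕ) : ℝ) - 1))))) :=
  rawEntryLetters_toMatrix_localDeltaA_scaledPencil i w (Matrix.stdBasis ℂ (Fin N) (Fin N)) U₀ η (norm_unit_le_one_of_mem i hG hU₀).1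
    (norm_unit_le_one_of_mem i hG hU₀).2 le_rfl hRc hw hcw hwQ (by positivity) (by positivity) (sum_abs_curlK_le i) (sum_abs_cocurlK_le i) (by positivity)
    (card_filter_edgeY_le i) zero_le_one zero_le_two (ca_globalBand_nonneg i) (hcQ_le_one i) (hcQs_le_two i) (hca_of_globalBand i) norm_stdBasis_repr_le zero_le_one
    norm_stdBasis_le_one zero_le_one (bondReadingY i hNf) (hℓp_bondReadingY_rangeQ2 i hNf) (hℓq_bondReadingY i hNf) hρ

end Located

end Literature.MathematicalPhysics.QuantumFieldTheory.Balaban1983to89.B13DeltaALocalScaledPencil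

end
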